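import Summits.CriticalPhenomena.PercolationContinuityZ3.Theorems.PercNearOneGluingNoHeavyLowerTailSahiTwoChainLattice
import Summits.CriticalPhenomena.PercolationContinuityZ3.Theorems.PercNearOneGluingNoHeavyLowerTailSahiPrincipalCycleBlocks
import HarnessLib

/-!
# Every increasing event of the root cluster of a weighted cycle: Sahi positivity of every order

Support file for the Sahi programme (`--supports stmt-CriticalPhenomena-4575`, prover prim-sahi-p2 gen 9).
No definitions, no named facts, no sorries; standard axioms.  Memo `…/prim-sahi-p2/PROOF-E3.md` §20g–h.

`IncStarCycle.sahiE_upperCluster_cycle_nonneg`: on the cycle `Fin m` (`m ≥ 3`, weights vanishing off the edges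
`s(j, j+1)`, root `0`), for finite sets `𝒰_i` of finite target sets the events `A_i = ⋃_{U∈𝒰_i} {C_0 ⊇ U}
= ⋃_{U∈𝒰_i} ⋂_{t∈U}{0 ↔ t}` — every up-set of the root cluster has this form — satisfy
`0 ≤ E_n(1_{A_0},…,1_{A_{n-1}})` for every `n`.  One statement containing the point events (gen 8
`…IncStarCycle`), the cup events (gen 8 `…IncStarCycleGroups`) and the cap events (`…SahiPrincipalCycleBlocks`).
Proof: the arc form of `{0 ↔ t}` on positive-weight configurations + the abstract theorem
`TwoChainCaps.sahiE_nonneg_of_twoChainCupCaps` (`…SahiTwoChainLattice.lean`).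
-/

noncomputable section

namespace Summit.CriticalPhenomena.PercolationContinuityZ3.Theorems


namespace IncStarCycle

open Finset MeasureTheory Literature.Combinatorics.Sahi2008 Literature.Probability.Percolation
  Literature.Probability.LatticeModels
open Literature.Probability.Percolation.DecisionTree (ind ind_of_mem ind_of_not_mem ind_nonneg)
open scoped Classical

variable {m : ℕ} [NeZero m]



/-- **Every family of increasing events of the root cluster of a weighted cycle is Sahi-positive at every order.**
Let `m ≥ 3` and let `w` vanish off the cycle edges `s(j, j+1)`.  For finite sets `𝒰_i` of finite target sets, the
events `A_i = ⋃_{U ∈ 𝒰_i} {C_0 ⊇ U} = ⋃_{U∈𝒰_i} ⋂_{t∈U} {0 ↔ t}` (every up-set of the root cluster has this form)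
satisfy `0 ≤ E_n(1_{A_0}, …, 1_{A_{n-1}})` under `bernoulliWeight w`. [this work] -/
theorem sahiE_upperCluster_cycle_nonneg (hm : 3 ≤ m) (w : Sym2 (Fin m) → unitInterval)
    (hw : ∀ e : Sym2 (Fin m), (∀ j : Fin m, e ≠ s(j, j + 1)) → w e = 0) (n : ℕ)
    (𝒰 : Fin n → Finset (Finset (Fin m))) :
    0 ≤ sahiE (bernoulliWeight w) n
      (fun i => ind (⋃ U ∈ 𝒰 i, ⋂ t ∈ U, (openConn (0 : Fin m) t : Set (BondConfig (Fin m))))) := by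
  let R : Fin m → Set (BondConfig (Fin m)) := fun v => {ω | ∀ j : Fin m, j.val < v.val → s(j, j + 1) ∈ ω}
  let L : Fin m → Set (BondConfig (Fin m)) := fun v => {ω | ∀ j : Fin m, v.val ≤ j.val → s(j, j + 1) ∈ ω}
  have harc : ∀ ω : BondConfig (Fin m), bernoulliWeight w ω ≠ 0 → ∀ v : Fin m,
      (ω ∈ openConn (0 : Fin m) v ↔ ω ∈ R v ∪ L v) := by
    intro ω hω v
    refine openConn_iff_arcs (by omega) (fun u u' hadj => ?_) v
    by_cases hne : ∃ k : Fin m, s(u, u') = s(k, k + 1)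
    · exact hne
    · exfalso
      rw [openGraph_adj] at hadj
      exact hω (bernoulliWeight_eq_zero_of_mem w hadj.1 (hw _ fun j hj => hne ⟨j, hj⟩))
  have hev : ∀ ω : BondConfig (Fin m), bernoulliWeight w ω ≠ 0 → ∀ 𝒱 : Finset (Finset (Fin m)),
      (ω ∈ (⋃ U ∈ 𝒱, ⋂ t ∈ U, (openConn (0 : Fin m) t : Set (BondConfig (Fin m)))) ↔
        ω ∈ (⋃ U ∈ 𝒱, ⋂ t ∈ U, (R t ∪ L t))) := by
    intro ω hω 𝒱
    simp only [Set.mem_iUnion, Set.mem_iInter]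
    refine exists_congr fun U => exists_congr fun _ => forall₂_congr fun t _ => ?_
    exact harc ω hω t
  have hmom : ∀ S : Finset (Fin n),
      ex (bernoulliWeight w) (∏ i ∈ S, ind (⋃ U ∈ 𝒰 i, ⋂ t ∈ U, (openConn (0 : Fin m) t : Set (BondConfig (Fin m))))) =
        ex (bernoulliWeight w) (∏ i ∈ S, ind (⋃ U ∈ 𝒰 i, ⋂ t ∈ U, (R t ∪ L t))) := by
    intro S
    rw [ex_def, ex_def]
    refine Finset.sum_congr rfl fun ω _ => ?_
    by_cases hω : bernoulliWeight w ω = 0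
    · rw [hω, zero_mul, zero_mul]
    · congr 1
      rw [Finset.prod_apply, Finset.prod_apply]
      refine Finset.prod_congr rfl fun i _ => ?_
      by_cases h : ω ∈ (⋃ U ∈ 𝒰 i, ⋂ t ∈ U, (openConn (0 : Fin m) t : Set (BondConfig (Fin m))))
      · rw [ind_of_mem h, ind_of_mem ((hev ω hω (𝒰 i)).1 h)]
      · rw [ind_of_not_mem h, ind_of_not_mem (fun h' => h ((hev ω hω (𝒰 i)).2 h'))]
  rw [TwoChainUnions.sahiE_congr_of_prodMoments (bernoulliWeight w) (bernoulliWeight w) n _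
    (fun i => ind (⋃ U ∈ 𝒰 i, ⋂ t ∈ U, (R t ∪ L t))) hmom]
  exact TwoChainCaps.sahiE_nonneg_of_twoChainCupCaps (bernoulliWeight w)
    (isFKGMeasure_bernoulliWeight w).nonneg (sum_bernoulliWeight w) R L
    (fun v v' h _ hω j hj => hω j (lt_of_lt_of_le hj (Fin.le_def.1 h)))
    (fun v v' h _ hω j hj => hω j (le_trans (Fin.le_def.1 h) hj))
    (fun v v' hvv' => ex_ind_rightArc_mul_leftArc hm w hvv') n 𝒰

end IncStarCycle

end Summit.CriticalPhenomena.PercolationContinuityZ3.Theorems
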